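import Summits.BirchSwinnertonDyer.Rank1Residual.X10.SelmerCompanionsTamagawaFree
import Literature.NumberTheory.EllipticCurves.Fisher2012.HesseFamilyThreeCongruenceProofs
import HarnessLib

/-!
# Selmer companions ALONG THE HESSE PENCIL at `p = 3`: the unit law and the Ш law for the
# one-parameter family `E_{λ,μ}` of curves `3`-congruent to `E` (cell `b2b-bsdres`, unit
# `b2b-bsdres-x10` = N2 class lead, GEN 29; TOOL — theorems only, no definition, no named fact of its
# own, nothing booked)

HONEST FRAMING (run/shared/lean/b2b/bsd-rank1-residual/, verbatim in every file): the goal of the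
cell is to DELETE the COMBINATION-SHAPED residual classes of the Birch–Swinnerton-Dyer formula for
ALL analytic-rank `≤ 1` elliptic curves over `ℚ` — "full BSD formula for every rank `≤ 1` curve in
class `C`" assembled STRICTLY from published theorems — so that the rank-`≤ 1` remainder becomes
exactly the CONSTRUCTION-SHAPED classes, which are TYPED (missing-input `Prop`s), NOT attempted.
This is not "finishing BSD". Class X10b (= N2) keeps its label CONSTRUCTION-SHAPED (NEEDS `X_A3`,
referee R82.3 / RESIDUAL-MAP §I N2); this file is a TOOL; no mark / label / tier / count moves.

## What

`X10/SelmerCompanionsTamagawaFree.lean` (x10 GEN 29) proves, for `p`-congruent curves `E, E′/ℚ` both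
good at `p` with `p ∤ Tam(E)`, `p ∤ Tam(E′)`: `#Sel^(p)(E′) = #Sel^(p)(E)` (Mazur–Rubin 2015 at `p` =
named fact `hMR`; Milne I.3.8 off `p` = n1011's row T-URTAM), with the congruence `θ : E′[p] ⥲ E[p]`
DISPLAYED. Along the `n = 3` Hesse pencil the congruence is a TREE THEOREM: Fisher 2012 Thm. 13.2 as
proved by team n1011 (`Fisher2012.threeCongruent_hessePencil3_unconditional`,
`threeCongruent_of_hesseCertificate_unconditional`): every non-singular member
`E_{λ,μ} : y² = x³ − 27𝔠₄(λ,μ)x − 54𝔠₆(λ,μ)` of the Hesse pencil of `E` has `E_{λ,μ}[3] ≅ E[3]` as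
`Γ_ℚ`-modules. Hence, with NO congruence binder:

* §1 **`natCard_selmerGroup_hessePencil3_eq`** — `E` good at `3`, `3 ∤ Tam(E)`; `E_{λ,μ}` non-singular,
  good at `3`, `3 ∤ Tam(E_{λ,μ})` ⟹ `#Sel₃(E_{λ,μ}/ℚ) = #Sel₃(E/ℚ)`.
  **UNIT LAW `rank_zero_hessePencil3_of_natCard_selmerGroup_eq_one`** — if moreover `#Sel₃(E/ℚ) = 1`
  (a UNIT cell) then `rank E_{λ,μ}(ℚ) = 0`, `E_{λ,μ}(ℚ)[3] = 0`, `Ш(E_{λ,μ}/ℚ)[3^∞] = 0`.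
  **Ш LAW `natCard_sha_torsion_hessePencil3_eq_of_rank_zero`** — if `#Sel₃(E/ℚ) = 9`, `E[3]` is
  irreducible and `rank E_{λ,μ}(ℚ) = 0` then `#Ш(E_{λ,μ}/ℚ)[3] = 9`.
* §2 the same three for ANY curve `G/ℚ` carrying a Hesse certificate `(l, m, u)`
  (`𝔠₄(l,m) = u⁴c₄(G)`, `𝔠₆(l,m) = u⁶c₆(G)`: `G ≅ E_{l,m}` over `ℚ`) — the shape of the cell's `X3E`
  certificates (cc-eng-2) and of x10 GEN 27's pencil jobs.
* §3 the DUAL pencil `E⁻_{λ,μ}` (Fisher §13, the `X_E⁻(3)` analogue of Thm. 13.2): the same three,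
  CONDITIONAL on the named fact `thm132rev_threeCongruent_dualHessePencil` (`hF`); this is where x10
  GEN 27 found the Tamagawa-`3`-free members (TRIVIAL-ROADS memo §4: `118810q1` ≥ 11, `147392bp1` 654,
  `38870bf1` 19, Ш-cells `453152bq1` 514 / `264992dm1` 590 members with `[0,0]` 2-descent ×353 / ×407 and
  `Ш_an = 9, 9, 9, 225` on the computable ones).

All statements CONDITIONAL on `hMR` (Mazur–Rubin 2015 Thm. 3.1 (iv)(b)); the census values
`#Sel₃(E) = 1 / 9` and the Tamagawa / good-at-`3` side conditions of the MEMBER stay displayed binders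
(per member: Tate's algorithm; `3 ∤ Δ`). N2 reading: for each of the 77 UNIT cells the Hesse pencil and
its dual are one-parameter families of UNIT curves off the Tamagawa-`3` locus; for each of the six
Ш-cells they are MACHINES producing `Ш[3] ≅ (ℤ/3)²` at every rank-`0` Tamagawa-`3`-free good-at-`3`
member (memo (C3), (C4)). Evidence about families; nothing booked; no count of record moves.

## References

* [Fisher2012Hessian] T. Fisher, *The Hessian of a genus one curve*, Proc. LMS 104 (2012), Thm. 13.2, §§8–9, §13.
* [MazurRubin2015SelmerCompanions] B. Mazur, K. Rubin, *Selmer companion curves*, TAMS 367 (2015), Thm. 3.1.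
* [MilneADT2006] J. S. Milne, *Arithmetic Duality Theorems*, 2nd ed., I Prop. 3.8, Rem. 3.10.
* [SilvermanAEC2009] J. H. Silverman, *AEC*, Thm. X.4.2, Cor. VII.6.2.
* HOME/class-closure/N2/TRIVIAL-ROADS-x10g27.md §§1, 4; HOME/X10-AUDIT.md §35.
-/

set_option autoImplicit false

noncomputable section

open scoped Classical

open WeierstrassCurve Literature.NumberTheory.EllipticCurves
  Literature.NumberTheory.GaloisRepresentations Field NumberField IsDedekindDomain
open Literature.NumberTheory.EllipticCurves.MazurRubin2015
open Literature.NumberTheory.EllipticCurves.Fisher2012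
open Summit.BirchSwinnertonDyer.Rank1Residual.X10.SelmerCompanionsTamagawaFree

namespace Summit.BirchSwinnertonDyer.Rank1Residual.X10.HessePencilCompanions

/-! ### §0. The `p = 3` instances of the companion tool (congruence displayed) -/

section Three

variable (W W' : WeierstrassCurve ℚ) [W.IsElliptic] [W'.IsElliptic]

/-- (C-i) at `p = 3` with the congruence `θ : E′[3] ⥲ E[3]` displayed: both curves good at `3`,
`3 ∤ Tam(E)`, `3 ∤ Tam(E′)` ⟹ `#Sel₃(E′/ℚ) = #Sel₃(E/ℚ)`. CONDITIONAL on `hMR`.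
[cite: MazurRubin2015SelmerCompanions, Thm. 3.1 (iv)(b)] [cite: MilneADT2006, Ch. I Prop. 3.8 and Remark 3.10] -/
theorem natCard_selmerGroup_three_eq_of_congr
    (hMR : selmerLocalKer_iff_of_goodReduction_above)
    (θ : geomTorsion W' (3 : ℤ) ≃+ geomTorsion W (3 : ℤ))
    (hθ : ∀ (σ : absoluteGaloisGroup ℚ) (P : geomTorsion W' (3 : ℤ)), θ (σ • P) = σ • θ P)
    (hgood : ∀ v : HeightOneSpectrum (𝓞 ℚ), (3 : 𝓞 ℚ) ∈ v.asIdeal →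
      W.HasGoodReductionAt v ∧ W'.HasGoodReductionAt v)
    (htam : ¬ 3 ∣ W.tamagawaProduct) (htam' : ¬ 3 ∣ W'.tamagawaProduct) :
    Nat.card (W'.selmerGroup (3 : ℤ)) = Nat.card (W.selmerGroup (3 : ℤ)) :=
  haveI : Fact (Nat.Prime 3) := ⟨Nat.prime_three⟩
  natCard_selmerGroup_eq_of_congr_of_not_dvd_tamagawaProduct_rat (p := 3) W W' hMR (by decide) θ hθ
    (fun v hv ↦ hgood v (by exact_mod_cast hv)) htam htam'

/-- (C-iii) at `p = 3`, congruence displayed: `#Sel₃(E/ℚ) = 1` ⟹ `rank E′(ℚ) = 0`, `E′(ℚ)[3] = 0`,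
`Ш(E′/ℚ)[3^∞] = 0`. CONDITIONAL on `hMR`. [cite: MazurRubin2015SelmerCompanions, Thm. 3.1 (iv)(b)]
[cite: SilvermanAEC2009, Thm. X.4.2] -/
theorem rank_zero_of_congr_three_of_natCard_selmerGroup_eq_one
    (hMR : selmerLocalKer_iff_of_goodReduction_above)
    (θ : geomTorsion W' (3 : ℤ) ≃+ geomTorsion W (3 : ℤ))
    (hθ : ∀ (σ : absoluteGaloisGroup ℚ) (P : geomTorsion W' (3 : ℤ)), θ (σ • P) = σ • θ P)
    (hgood : ∀ v : HeightOneSpectrum (𝓞 ℚ), (3 : 𝓞 ℚ) ∈ v.asIdeal →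
      W.HasGoodReductionAt v ∧ W'.HasGoodReductionAt v)
    (htam : ¬ 3 ∣ W.tamagawaProduct) (htam' : ¬ 3 ∣ W'.tamagawaProduct)
    (hSel : Nat.card (W.selmerGroup (3 : ℤ)) = 1) :
    W'.mordellWeilRank = 0 ∧ AddSubgroup.torsionBy W'.toAffine.Point (3 : ℤ) = ⊥ ∧
      AddCommGroup.primaryComponent W'.sha 3 = ⊥ :=
  haveI : Fact (Nat.Prime 3) := ⟨Nat.prime_three⟩
  rank_zero_of_congr_of_natCard_selmerGroup_eq_one_rat (p := 3) W W' hMR (by decide) θ hθ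
    (fun v hv ↦ hgood v (by exact_mod_cast hv)) htam htam' hSel

/-- (C-ii) sharp form at `p = 3`, congruence displayed: `#Sel₃(E/ℚ) = 9`, `E[3]` irreducible,
`rank E′(ℚ) = 0` ⟹ `#Ш(E′/ℚ)[3] = 9`. CONDITIONAL on `hMR`.
[cite: MazurRubin2015SelmerCompanions, Thm. 3.1 (iv)(b)] [cite: SilvermanAEC2009, Thm. X.4.2] -/
theorem natCard_sha_torsion_three_eq_of_congr_of_rank_zero
    (hMR : selmerLocalKer_iff_of_goodReduction_above)
    (θ : geomTorsion W' (3 : ℤ) ≃+ geomTorsion W (3 : ℤ))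
    (hθ : ∀ (σ : absoluteGaloisGroup ℚ) (P : geomTorsion W' (3 : ℤ)), θ (σ • P) = σ • θ P)
    (hgood : ∀ v : HeightOneSpectrum (𝓞 ℚ), (3 : 𝓞 ℚ) ∈ v.asIdeal →
      W.HasGoodReductionAt v ∧ W'.HasGoodReductionAt v)
    (htam : ¬ 3 ∣ W.tamagawaProduct) (htam' : ¬ 3 ∣ W'.tamagawaProduct)
    (hirr : W.HasIrreducibleModPGaloisRep 3)
    (hSel : Nat.card (W.selmerGroup (3 : ℤ)) = 9) (hrank : W'.mordellWeilRank = 0) :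
    Nat.card (W'.sha ⊓ AddSubgroup.torsionBy W'.galH1 (3 : ℤ) : AddSubgroup W'.galH1) = 9 :=
  haveI : Fact (Nat.Prime 3) := ⟨Nat.prime_three⟩
  natCard_sha_torsion_eq_sq_of_congr_of_rank_zero_rat (p := 3) W W' hMR (by decide) θ hθ
    (fun v hv ↦ hgood v (by exact_mod_cast hv)) htam htam' hirr hSel hrank

end Three

/-! ### §1. The direct Hesse pencil `E_{λ,μ}` (Fisher 2012 Thm. 13.2, proved in the tree) -/

section Pencil

variable (W : WeierstrassCurve ℚ) [W.IsElliptic] (l m : ℚ) [(hessePencil3 W.c₄ W.c₆ l m).IsElliptic]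

/-- **Selmer companions along the Hesse pencil.** `E/ℚ` good at `3` with `3 ∤ Tam(E)`; `E_{λ,μ}` a
non-singular member of the `n = 3` Hesse pencil of `E` (Fisher 2012 Thm. 13.2: `E_{λ,μ}[3] ≅ E[3]`,
tree theorem `threeCongruent_hessePencil3_unconditional`), good at `3` with `3 ∤ Tam(E_{λ,μ})`. Then
`#Sel₃(E_{λ,μ}/ℚ) = #Sel₃(E/ℚ)`. CONDITIONAL on `hMR` only; NO congruence binder.
[cite: Fisher2012Hessian, Thm. 13.2 (n = 3)] [cite: MazurRubin2015SelmerCompanions, Thm. 3.1 (iv)(b)]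
[cite: MilneADT2006, Ch. I Prop. 3.8 and Remark 3.10] -/
theorem natCard_selmerGroup_hessePencil3_eq (hMR : selmerLocalKer_iff_of_goodReduction_above)
    (hgood : ∀ v : HeightOneSpectrum (𝓞 ℚ), (3 : 𝓞 ℚ) ∈ v.asIdeal →
      W.HasGoodReductionAt v ∧ (hessePencil3 W.c₄ W.c₆ l m).HasGoodReductionAt v)
    (htam : ¬ 3 ∣ W.tamagawaProduct) (htam' : ¬ 3 ∣ (hessePencil3 W.c₄ W.c₆ l m).tamagawaProduct) :
    Nat.card ((hessePencil3 W.c₄ W.c₆ l m).selmerGroup (3 : ℤ)) =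
      Nat.card (W.selmerGroup (3 : ℤ)) := by
  obtain ⟨e, he⟩ := threeCongruent_hessePencil3_unconditional W l m
  exact natCard_selmerGroup_three_eq_of_congr W _ hMR e he hgood htam htam'

/-- **THE UNIT LAW ON THE HESSE PENCIL.** `E/ℚ` a UNIT curve at `3` in the Selmer sense
(`#Sel₃(E/ℚ) = 1`), good at `3`, `3 ∤ Tam(E)`. Then EVERY non-singular member `E_{λ,μ}` (`λ, μ ∈ ℚ`)
of its Hesse pencil that is good at `3` with `3 ∤ Tam(E_{λ,μ})` satisfies
**`rank E_{λ,μ}(ℚ) = 0`, `E_{λ,μ}(ℚ)[3] = 0`, `Ш(E_{λ,μ}/ℚ)[3^∞] = 0`**. N2 reading: the 77 UNIT cells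
(TRIVIAL-ROADS memo §3) each carry a one-parameter family of unit curves. CONDITIONAL on `hMR`;
`#Sel₃(E) = 1` is the census binder (x10b / cc-eng-4 descent line). Nothing booked.
[cite: Fisher2012Hessian, Thm. 13.2 (n = 3)] [cite: MazurRubin2015SelmerCompanions, Thm. 3.1 (iv)(b)]
[cite: SilvermanAEC2009, Thm. X.4.2] -/
theorem rank_zero_hessePencil3_of_natCard_selmerGroup_eq_one
    (hMR : selmerLocalKer_iff_of_goodReduction_above)
    (hgood : ∀ v : HeightOneSpectrum (𝓞 ℚ), (3 : 𝓞 ℚ) ∈ v.asIdeal →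
      W.HasGoodReductionAt v ∧ (hessePencil3 W.c₄ W.c₆ l m).HasGoodReductionAt v)
    (htam : ¬ 3 ∣ W.tamagawaProduct) (htam' : ¬ 3 ∣ (hessePencil3 W.c₄ W.c₆ l m).tamagawaProduct)
    (hSel : Nat.card (W.selmerGroup (3 : ℤ)) = 1) :
    (hessePencil3 W.c₄ W.c₆ l m).mordellWeilRank = 0 ∧
      AddSubgroup.torsionBy (hessePencil3 W.c₄ W.c₆ l m).toAffine.Point (3 : ℤ) = ⊥ ∧
        AddCommGroup.primaryComponent (hessePencil3 W.c₄ W.c₆ l m).sha 3 = ⊥ := by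
  obtain ⟨e, he⟩ := threeCongruent_hessePencil3_unconditional W l m
  exact rank_zero_of_congr_three_of_natCard_selmerGroup_eq_one W _ hMR e he hgood htam htam' hSel

/-- **THE Ш LAW ON THE HESSE PENCIL.** `E/ℚ` with `#Sel₃(E/ℚ) = 9` and `E[3]` irreducible, good at
`3`, `3 ∤ Tam(E)`. Then every non-singular member `E_{λ,μ}` good at `3` with `3 ∤ Tam(E_{λ,μ})` and
`rank E_{λ,μ}(ℚ) = 0` has **`#Ш(E_{λ,μ}/ℚ)[3] = 9`** (`Ш[3] ≅ (ℤ/3)²`). N2 reading: the six Ш-cells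
(`dim Sel₃ = 2` EXACT, `T_E = ∅`) as machines for certified `9 ∣ #Ш` (memo (C4)). CONDITIONAL on `hMR`.
[cite: Fisher2012Hessian, Thm. 13.2 (n = 3)] [cite: MazurRubin2015SelmerCompanions, Thm. 3.1 (iv)(b)]
[cite: SilvermanAEC2009, Thm. X.4.2] -/
theorem natCard_sha_torsion_hessePencil3_eq_of_rank_zero
    (hMR : selmerLocalKer_iff_of_goodReduction_above)
    (hgood : ∀ v : HeightOneSpectrum (𝓞 ℚ), (3 : 𝓞 ℚ) ∈ v.asIdeal →
      W.HasGoodReductionAt v ∧ (hessePencil3 W.c₄ W.c₆ l m).HasGoodReductionAt v)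
    (htam : ¬ 3 ∣ W.tamagawaProduct) (htam' : ¬ 3 ∣ (hessePencil3 W.c₄ W.c₆ l m).tamagawaProduct)
    (hirr : W.HasIrreducibleModPGaloisRep 3) (hSel : Nat.card (W.selmerGroup (3 : ℤ)) = 9)
    (hrank : (hessePencil3 W.c₄ W.c₆ l m).mordellWeilRank = 0) :
    Nat.card ((hessePencil3 W.c₄ W.c₆ l m).sha ⊓
        AddSubgroup.torsionBy (hessePencil3 W.c₄ W.c₆ l m).galH1 (3 : ℤ) :
          AddSubgroup (hessePencil3 W.c₄ W.c₆ l m).galH1) = 9 := by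
  obtain ⟨e, he⟩ := threeCongruent_hessePencil3_unconditional W l m
  exact natCard_sha_torsion_three_eq_of_congr_of_rank_zero W _ hMR e he hgood htam htam' hirr hSel
    hrank

end Pencil

/-! ### §2. Any curve with a Hesse certificate `(l, m, u)` (the cell's `X3E` / pencil-job shape) -/

section Certificate

variable (W G : WeierstrassCurve ℚ) [W.IsElliptic] [G.IsElliptic]

/-- **Selmer companions from a Hesse certificate.** `𝔠₄(l,m) = u⁴c₄(G)`, `𝔠₆(l,m) = u⁶c₆(G)`, `u ≠ 0`
(`G ≅ E_{l,m}` over `ℚ`; tree theorem `threeCongruent_of_hesseCertificate_unconditional`), both curves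
good at `3`, `3 ∤ Tam(E)`, `3 ∤ Tam(G)` ⟹ `#Sel₃(G/ℚ) = #Sel₃(E/ℚ)`. CONDITIONAL on `hMR`.
[cite: Fisher2012Hessian, Thm. 13.2 (n = 3)] [cite: MazurRubin2015SelmerCompanions, Thm. 3.1 (iv)(b)]
[cite: MilneADT2006, Ch. I Prop. 3.8 and Remark 3.10] -/
theorem natCard_selmerGroup_eq_of_hesseCertificate (hMR : selmerLocalKer_iff_of_goodReduction_above)
    (l m u : ℚ) (hu : u ≠ 0)
    (h4 : MvPolynomial.eval ![l, m] (hesseC4three W.c₄ W.c₆) = u ^ 4 * G.c₄)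
    (h6 : MvPolynomial.eval ![l, m] (hesseC6three W.c₄ W.c₆) = u ^ 6 * G.c₆)
    (hgood : ∀ v : HeightOneSpectrum (𝓞 ℚ), (3 : 𝓞 ℚ) ∈ v.asIdeal →
      W.HasGoodReductionAt v ∧ G.HasGoodReductionAt v)
    (htam : ¬ 3 ∣ W.tamagawaProduct) (htam' : ¬ 3 ∣ G.tamagawaProduct) :
    Nat.card (G.selmerGroup (3 : ℤ)) = Nat.card (W.selmerGroup (3 : ℤ)) := by
  obtain ⟨e, he⟩ := threeCongruent_of_hesseCertificate_unconditional W G l m u hu h4 h6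
  exact natCard_selmerGroup_three_eq_of_congr W G hMR e he hgood htam htam'

/-- **Unit law from a Hesse certificate**: `#Sel₃(E/ℚ) = 1` ⟹ `rank G(ℚ) = 0`, `G(ℚ)[3] = 0`,
`Ш(G/ℚ)[3^∞] = 0`. CONDITIONAL on `hMR`. [cite: Fisher2012Hessian, Thm. 13.2 (n = 3)]
[cite: MazurRubin2015SelmerCompanions, Thm. 3.1 (iv)(b)] [cite: SilvermanAEC2009, Thm. X.4.2] -/
theorem rank_zero_of_hesseCertificate_of_natCard_selmerGroup_eq_one
    (hMR : selmerLocalKer_iff_of_goodReduction_above) (l m u : ℚ) (hu : u ≠ 0)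
    (h4 : MvPolynomial.eval ![l, m] (hesseC4three W.c₄ W.c₆) = u ^ 4 * G.c₄)
    (h6 : MvPolynomial.eval ![l, m] (hesseC6three W.c₄ W.c₆) = u ^ 6 * G.c₆)
    (hgood : ∀ v : HeightOneSpectrum (𝓞 ℚ), (3 : 𝓞 ℚ) ∈ v.asIdeal →
      W.HasGoodReductionAt v ∧ G.HasGoodReductionAt v)
    (htam : ¬ 3 ∣ W.tamagawaProduct) (htam' : ¬ 3 ∣ G.tamagawaProduct)
    (hSel : Nat.card (W.selmerGroup (3 : ℤ)) = 1) :
    G.mordellWeilRank = 0 ∧ AddSubgroup.torsionBy G.toAffine.Point (3 : ℤ) = ⊥ ∧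
      AddCommGroup.primaryComponent G.sha 3 = ⊥ := by
  obtain ⟨e, he⟩ := threeCongruent_of_hesseCertificate_unconditional W G l m u hu h4 h6
  exact rank_zero_of_congr_three_of_natCard_selmerGroup_eq_one W G hMR e he hgood htam htam' hSel

/-- **Ш law from a Hesse certificate**: `#Sel₃(E/ℚ) = 9`, `E[3]` irreducible, `rank G(ℚ) = 0` ⟹
`#Ш(G/ℚ)[3] = 9`. CONDITIONAL on `hMR`. [cite: Fisher2012Hessian, Thm. 13.2 (n = 3)]
[cite: MazurRubin2015SelmerCompanions, Thm. 3.1 (iv)(b)] [cite: SilvermanAEC2009, Thm. X.4.2] -/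
theorem natCard_sha_torsion_eq_of_hesseCertificate_of_rank_zero
    (hMR : selmerLocalKer_iff_of_goodReduction_above) (l m u : ℚ) (hu : u ≠ 0)
    (h4 : MvPolynomial.eval ![l, m] (hesseC4three W.c₄ W.c₆) = u ^ 4 * G.c₄)
    (h6 : MvPolynomial.eval ![l, m] (hesseC6three W.c₄ W.c₆) = u ^ 6 * G.c₆)
    (hgood : ∀ v : HeightOneSpectrum (𝓞 ℚ), (3 : 𝓞 ℚ) ∈ v.asIdeal →
      W.HasGoodReductionAt v ∧ G.HasGoodReductionAt v)
    (htam : ¬ 3 ∣ W.tamagawaProduct) (htam' : ¬ 3 ∣ G.tamagawaProduct)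
    (hirr : W.HasIrreducibleModPGaloisRep 3) (hSel : Nat.card (W.selmerGroup (3 : ℤ)) = 9)
    (hrank : G.mordellWeilRank = 0) :
    Nat.card (G.sha ⊓ AddSubgroup.torsionBy G.galH1 (3 : ℤ) : AddSubgroup G.galH1) = 9 := by
  obtain ⟨e, he⟩ := threeCongruent_of_hesseCertificate_unconditional W G l m u hu h4 h6
  exact natCard_sha_torsion_three_eq_of_congr_of_rank_zero W G hMR e he hgood htam htam' hirr hSel
    hrank

end Certificate

/-! ### §3. The DUAL Hesse pencil `E⁻_{λ,μ}` (Fisher 2012 §13; named fact `hF`) -/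

section Dual

variable (W G : WeierstrassCurve ℚ) [W.IsElliptic] [G.IsElliptic]

/-- **Selmer companions from a DUAL Hesse certificate** (`−𝔇(l,m)/(4Δ′) = u⁴c₄(G)`,
`−𝔠₆(l,m)/(8Δ′²) = u⁶c₆(G)`, `Δ′ = c₄³ − c₆²`; `G ≅ E⁻_{l,m}`): both curves good at `3`, `3 ∤ Tam(E)`,
`3 ∤ Tam(G)` ⟹ `#Sel₃(G/ℚ) = #Sel₃(E/ℚ)`. CONDITIONAL on `hF` (Fisher §13, the `X_E⁻(3)` analogue of
Thm. 13.2 — a named fact) and `hMR`. This is the family where x10 GEN 27 found the Tamagawa-`3`-free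
companions beyond Cremona's table. [cite: Fisher2012Hessian, §13 (analogue of Thm. 13.2 for X_E^-(3))]
[cite: MazurRubin2015SelmerCompanions, Thm. 3.1 (iv)(b)] [cite: MilneADT2006, Ch. I Prop. 3.8 and Remark 3.10] -/
theorem natCard_selmerGroup_eq_of_dualHesseCertificate (hF : thm132rev_threeCongruent_dualHessePencil)
    (hMR : selmerLocalKer_iff_of_goodReduction_above) (l m u : ℚ) (hu : u ≠ 0)
    (h4 : -MvPolynomial.eval ![l, m] (hesseD3 W.c₄ W.c₆) / (4 * (W.c₄ ^ 3 - W.c₆ ^ 2)) = u ^ 4 * G.c₄)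
    (h6 : -MvPolynomial.eval ![l, m] (hesseC6three W.c₄ W.c₆) / (8 * (W.c₄ ^ 3 - W.c₆ ^ 2) ^ 2) =
      u ^ 6 * G.c₆)
    (hgood : ∀ v : HeightOneSpectrum (𝓞 ℚ), (3 : 𝓞 ℚ) ∈ v.asIdeal →
      W.HasGoodReductionAt v ∧ G.HasGoodReductionAt v)
    (htam : ¬ 3 ∣ W.tamagawaProduct) (htam' : ¬ 3 ∣ G.tamagawaProduct) :
    Nat.card (G.selmerGroup (3 : ℤ)) = Nat.card (W.selmerGroup (3 : ℤ)) := by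
  obtain ⟨e, he⟩ := threeCongruent_of_dualHesseCertificate hF W G l m u hu h4 h6
  exact natCard_selmerGroup_three_eq_of_congr W G hMR e he hgood htam htam'

/-- **Unit law from a DUAL Hesse certificate**: `#Sel₃(E/ℚ) = 1` ⟹ `rank G(ℚ) = 0`, `G(ℚ)[3] = 0`,
`Ш(G/ℚ)[3^∞] = 0`. N2 reading: every Tamagawa-`3`-free good-at-`3` member of the dual Hesse family of a
UNIT cell — e.g. the 654 members found for `147392bp1` (457 of them rank `0` by `2`-descent, 11 with a
computable `L`-value and `3 ∤ Ш_an`; memo §4) — is a unit curve. CONDITIONAL on `hF`, `hMR`.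
[cite: Fisher2012Hessian, §13 (analogue of Thm. 13.2 for X_E^-(3))]
[cite: MazurRubin2015SelmerCompanions, Thm. 3.1 (iv)(b)] [cite: SilvermanAEC2009, Thm. X.4.2] -/
theorem rank_zero_of_dualHesseCertificate_of_natCard_selmerGroup_eq_one
    (hF : thm132rev_threeCongruent_dualHessePencil)
    (hMR : selmerLocalKer_iff_of_goodReduction_above) (l m u : ℚ) (hu : u ≠ 0)
    (h4 : -MvPolynomial.eval ![l, m] (hesseD3 W.c₄ W.c₆) / (4 * (W.c₄ ^ 3 - W.c₆ ^ 2)) = u ^ 4 * G.c₄)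
    (h6 : -MvPolynomial.eval ![l, m] (hesseC6three W.c₄ W.c₆) / (8 * (W.c₄ ^ 3 - W.c₆ ^ 2) ^ 2) =
      u ^ 6 * G.c₆)
    (hgood : ∀ v : HeightOneSpectrum (𝓞 ℚ), (3 : 𝓞 ℚ) ∈ v.asIdeal →
      W.HasGoodReductionAt v ∧ G.HasGoodReductionAt v)
    (htam : ¬ 3 ∣ W.tamagawaProduct) (htam' : ¬ 3 ∣ G.tamagawaProduct)
    (hSel : Nat.card (W.selmerGroup (3 : ℤ)) = 1) :
    G.mordellWeilRank = 0 ∧ AddSubgroup.torsionBy G.toAffine.Point (3 : ℤ) = ⊥ ∧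
      AddCommGroup.primaryComponent G.sha 3 = ⊥ := by
  obtain ⟨e, he⟩ := threeCongruent_of_dualHesseCertificate hF W G l m u hu h4 h6
  exact rank_zero_of_congr_three_of_natCard_selmerGroup_eq_one W G hMR e he hgood htam htam' hSel

/-- **Ш law from a DUAL Hesse certificate**: `#Sel₃(E/ℚ) = 9`, `E[3]` irreducible, `rank G(ℚ) = 0` ⟹
`#Ш(G/ℚ)[3] = 9`. N2 reading: the rank-`0` members of the dual families of `453152bq1` (353 by
`2`-descent; `(14:1)`, `N = 13 338 758 868 064`, `Ш_an = 9`) and `264992dm1` (407; `Ш_an = 9, 9, 225`)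
carry `Ш[3] ≅ (ℤ/3)²` (memo §4, (C4)). CONDITIONAL on `hF`, `hMR`; `rank G(ℚ) = 0` is EVIDENCE per member.
[cite: Fisher2012Hessian, §13 (analogue of Thm. 13.2 for X_E^-(3))]
[cite: MazurRubin2015SelmerCompanions, Thm. 3.1 (iv)(b)] [cite: SilvermanAEC2009, Thm. X.4.2] -/
theorem natCard_sha_torsion_eq_of_dualHesseCertificate_of_rank_zero
    (hF : thm132rev_threeCongruent_dualHessePencil)
    (hMR : selmerLocalKer_iff_of_goodReduction_above) (l m u : ℚ) (hu : u ≠ 0)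
    (h4 : -MvPolynomial.eval ![l, m] (hesseD3 W.c₄ W.c₆) / (4 * (W.c₄ ^ 3 - W.c₆ ^ 2)) = u ^ 4 * G.c₄)
    (h6 : -MvPolynomial.eval ![l, m] (hesseC6three W.c₄ W.c₆) / (8 * (W.c₄ ^ 3 - W.c₆ ^ 2) ^ 2) =
      u ^ 6 * G.c₆)
    (hgood : ∀ v : HeightOneSpectrum (𝓞 ℚ), (3 : 𝓞 ℚ) ∈ v.asIdeal →
      W.HasGoodReductionAt v ∧ G.HasGoodReductionAt v)
    (htam : ¬ 3 ∣ W.tamagawaProduct) (htam' : ¬ 3 ∣ G.tamagawaProduct)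
    (hirr : W.HasIrreducibleModPGaloisRep 3) (hSel : Nat.card (W.selmerGroup (3 : ℤ)) = 9)
    (hrank : G.mordellWeilRank = 0) :
    Nat.card (G.sha ⊓ AddSubgroup.torsionBy G.galH1 (3 : ℤ) : AddSubgroup G.galH1) = 9 := by
  obtain ⟨e, he⟩ := threeCongruent_of_dualHesseCertificate hF W G l m u hu h4 h6
  exact natCard_sha_torsion_three_eq_of_congr_of_rank_zero W G hMR e he hgood htam htam' hirr hSel
    hrank

end Dual

/-! ### §4. Record vocabulary: the cell's side conditions from its integral model -/

/-- A globally minimal `W/ℚ` with integral model `integralModelInt W = E₀` and `3 ∤ Δ(E₀)` has good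
reduction at the place of `3` (`hasGoodReductionAt_map_of_not_dvd`; the shape `hI` of the
`X10/UnitRoad*` records, whose Tamagawa numerals `UnitRoad.tamagawaProduct_u<E>` discharge `3 ∤ Tam(E)`).
[cite: SilvermanAEC2009, VII.5 Prop. 5.1 (a)] -/
theorem hasGoodReductionAt_three_of_integralModelInt {W : WeierstrassCurve ℚ} [W.IsGloballyMinimal]
    {E₀ : WeierstrassCurve ℤ} (hI : integralModelInt W = E₀) (h3 : ¬ (3 : ℤ) ∣ E₀.Δ)
    (v : HeightOneSpectrum (𝓞 ℚ)) (hv : (3 : 𝓞 ℚ) ∈ v.asIdeal) : W.HasGoodReductionAt v :=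
  haveI : Fact (Nat.Prime 3) := ⟨Nat.prime_three⟩
  hasGoodReductionAt_of_map_eq_of_not_dvd (p := 3) W (hI ▸ map_integralModelInt W)
    (by exact_mod_cast h3) v (by exact_mod_cast hv)

end Summit.BirchSwinnertonDyer.Rank1Residual.X10.HessePencilCompanions

end
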